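import Summits.QuantumFields.YangMills.Theorems.UnitScaleTiltProp8HalvingAssemblyInterior
import HarnessLib

/-!
# Route `UnitScaleTilt`, crux K1 child «MinimiserStabilityRegPr» (stmt-QuantumFields-19200), registered stub V2′ `stub_halvingStep`
# (skeletons v8 5b4e846794b80374 / v10 `BirthV10`) — **NON-VACUITY OF THE INTERIOR ANALYTIC PACKAGE OF `HalvingAssemblyInterior` AT THE TRIVIAL CONFIGURATION**:
# the per-site `∃ u A A₁ R B, …` body of the package holds for `U = 1` with `u = 1`, `A = A₁ = R = 0`, `B = 0` — a letters∕signs sanity check of the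
# socket list of record (cf. w3 g0's `Prop8PullbackDict.localChart_top_one` for the socket of `Prop8LastMile`)

Cell `ym3-torus` (HUMAN RULING D-0037, YM ladder rung R3 — continuum SU(2) YM₃ on the torus is a RUNG, not the Clay problem), width seat
`ym-ust-19200-w3` gen 2 (D-0149).  `--supports stmt-QuantumFields-19200 --as helper`; def-free, 0 sorry, standard axioms.

WHAT THIS FILE PROVES: **`packageClause_one`** — for every site `x`, cube-sequence parameters and nonnegative sizes `C₁, C₂, K₁, K₂, ε₀, ε₁`, the per-site body of
`HalvingAssemblyInterior.H_of_packageInt`'s package at `U = 1` is inhabited by `u = 1`, `A = A₁ = R = 0`, `B = 0`: the chart clause reads `(1)⁻¹·1·1 = expUnit(iη·0)`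
(`T3PrintedRegularMinimiser.unitsField_toUField_one`, `Prop8PullbackDict.expUnit_zero`), the decomposition is `0 = 0 + Σ_c (flatH e_c)(b)·0 − 0`, and every letter
vanishes (`plaqCovDeriv_flat_pull_zero`, `pdiv_flat_zero`).  HONEST SCOPE: a consistency certificate of the TYPING of the package, not a step of the proof (that
`U = 1` minimises over (6) at `V = 1` is not used or proved here).  NOT a claim about the crux, the rung, or the mass gap.

References: T. Bałaban, CMP **102** (1985) 277–309 [Balaban1985Variational] (2) p.278, (159) p.303; CMP **99** (1985) 75–102 [Balaban1985RegularSpaces] (1.140) p.100.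
-/

set_option autoImplicit false

noncomputable section

open scoped BigOperators Matrix.Norms.L2Operator

namespace Summit.QuantumFields.YangMills.Theorems.HalvingPackageSanity

open Literature.MathematicalPhysics.QuantumFieldTheory.Balaban1983to89
open Complex (I)
open B5Eq117TorusCarriers (Mk)
open B5Eq118OneStroke (iterBlockOf)
open B5Prop12FieldsLattice (distSite distSite_nonneg)
open B6SectAOperatorsV1 (BondIdx)
open B7Prop1Explicit (expUnit)
open B8Ineq132 (BondTouches)
open B8Eq140Level (SideTouches)
open B8Eq143PlaqExpansion (pdiv)
open B8Eq146AExpansion (plaqCovDeriv)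
open B8Thm2SetupTorus (pullDom)
open B10Eq27TorusAxialLog (pull unitsField toUField transl)
open T3ContinuumYM3Torus (T3Family)
open FlatCubeSequenceAligned (cubeSeqMT3)
open FlatOpsLettersAssembly (flatH)

/-! ## §1 Non-vacuity: the flat configuration meets the interior package clause -/

section Sanity

variable {F : T3Family} {n K : ℕ}

/-- **NON-VACUITY OF THE INTERIOR PACKAGE CLAUSE AT `U = 1`** (letters∕signs sanity, cf. `Prop8PullbackDict.localChart_top_one`): for the trivial configuration and
every site, cube sequence and nonnegative sizes, the per-site `∃ u A A₁ R B, …` body of `H_of_packageInt`'s package holds with `u = 1`, `A = A₁ = R = 0`, `B = 0`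
(`(1)⁻¹·1·1 = expUnit 0`; every letter vanishes).  So the package is not contradictory as typed; at the flat datum `V = 1`, `U = 1` is the minimiser over (6).
[cite: Balaban1985Variational, (2) p.278 (the trivial configuration lies in every space (2)); Balaban1985RegularSpaces, (1.140) p.100] -/
theorem packageClause_one (x : Site (F.P K) 0) (ρ S M : ℕ) (hM : 1 ≤ M) {C₁ C₂ K₁ K₂ ε₀ ε₁ : ℝ} (hC₁ : 0 ≤ C₁) (hC₂ : 0 ≤ C₂)
    (hK₁ : 0 ≤ K₁) (hK₂ : 0 ≤ K₂) (hε₀ : 0 ≤ ε₀) (hε₁ : 0 ≤ ε₁) :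
    ∃ (u : GaugeTransf (F.P K) 0 (Matrix.unitaryGroup (Fin 2) ℂ)) (A A₁ R : PBond (F.P K) 0 → Matrix (Fin 2) (Fin 2) ℂ)
      (B : BondIdx (cubeSeqMT3 F n K x ρ S M hM) → Matrix (Fin 2) (Fin 2) ℂ),
      (∀ b : PBond (F.P K) 0, IsSelfAdjoint (A b)) ∧
      (∀ (z : B7Prop1Explicit.Site (F.P K).d) (μ : Fin (F.P K).d),
        SideTouches (pullDom (fun j => if K - n ≤ j then ({x} : Set (Site (F.P K) 0)) else (∅ : Set (Site (F.P K) 0))) (K - n)) z μ →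
        (Unitary.toUnits (u (transl 0 z)))⁻¹ *
            unitsField (toUField (1 : GaugeField (F.P K) 0 (Matrix.specialUnitaryGroup (Fin 2) ℂ))) ⟨transl 0 z, μ⟩ *
            Unitary.toUnits (u ((transl 0 z).shift μ)) =
          expUnit (I • ((((F.L : ℝ)⁻¹) ^ (K - n)) • A ⟨transl 0 z, μ⟩))) ∧
      (A = A₁ + (fun b => ∑ c, flatH F n K (cubeSeqMT3 F n K x ρ S M hM) (Pi.single c 1) b • B c) - R) ∧
      (∀ c : BondIdx (cubeSeqMT3 F n K x ρ S M hM), (c.1.1 : ℕ) = K - n →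
        c.1.2.src ∈ (cubeSeqMT3 F n K x ρ S M hM).Om (c.1.1 : ℕ) → c.1.2.tgt ∈ (cubeSeqMT3 F n K x ρ S M hM).Om (c.1.1 : ℕ) →
        ‖B c‖ ≤ C₁ * ε₁ * (distSite (Mk (F.P K) (c.1.1 : ℕ)) c.1.2.src (iterBlockOf (c.1.1 : ℕ) x) + 1)) ∧
      (∀ c : BondIdx (cubeSeqMT3 F n K x ρ S M hM),
        ¬ ((c.1.1 : ℕ) = K - n ∧ c.1.2.src ∈ (cubeSeqMT3 F n K x ρ S M hM).Om (c.1.1 : ℕ) ∧ c.1.2.tgt ∈ (cubeSeqMT3 F n K x ρ S M hM).Om (c.1.1 : ℕ)) →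
        ‖B c‖ ≤ C₂ * ε₀ * (F.L : ℝ) ^ ((K - n) - (c.1.1 : ℕ))) ∧
      (∀ (z : B7Prop1Explicit.Site (F.P K).d) (τ : Fin (F.P K).d),
        SideTouches (pullDom (fun j => if K - n ≤ j then ({x} : Set (Site (F.P K) 0)) else (∅ : Set (Site (F.P K) 0))) (K - n)) z τ →
        ‖A₁ ⟨transl 0 z, τ⟩‖ ≤ K₁ * ε₀ ^ 2) ∧
      (∀ (z : B7Prop1Explicit.Site (F.P K).d) (κ τ : Fin (F.P K).d),
        SideTouches (pullDom (fun j => if K - n ≤ j then ({x} : Set (Site (F.P K) 0)) else (∅ : Set (Site (F.P K) 0))) (K - n)) z τ →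
        ‖(((F.L : ℝ)⁻¹) ^ (K - n))⁻¹ • (A₁ ⟨(transl 0 z).shift κ, τ⟩ - A₁ ⟨transl 0 z, τ⟩)‖ ≤ K₁ * ε₀ ^ 2) ∧
      (∀ (z : B7Prop1Explicit.Site (F.P K).d) (μ : Fin (F.P K).d),
        BondTouches (pullDom (fun j => if K - n ≤ j then ({x} : Set (Site (F.P K) 0)) else (∅ : Set (Site (F.P K) 0))) (K - n)) z μ →
        ‖pdiv (((F.L : ℝ)⁻¹) ^ (K - n)) (1 : B7Prop1Explicit.Site (F.P K).d → Fin (F.P K).d → (Matrix (Fin 2) (Fin 2) ℂ)ˣ)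
            (plaqCovDeriv (((F.L : ℝ)⁻¹) ^ (K - n)) (1 : B7Prop1Explicit.Site (F.P K).d → Fin (F.P K).d → (Matrix (Fin 2) (Fin 2) ℂ)ˣ)
              (pull A₁ 0)) μ z‖ ≤ K₁ * ε₀ ^ 2) ∧
      (∀ (z : B7Prop1Explicit.Site (F.P K).d) (τ : Fin (F.P K).d),
        SideTouches (pullDom (fun j => if K - n ≤ j then ({x} : Set (Site (F.P K) 0)) else (∅ : Set (Site (F.P K) 0))) (K - n)) z τ →
        ‖R ⟨transl 0 z, τ⟩‖ ≤ K₂ * ε₀ ^ 2) ∧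
      (∀ (z : B7Prop1Explicit.Site (F.P K).d) (κ τ : Fin (F.P K).d),
        SideTouches (pullDom (fun j => if K - n ≤ j then ({x} : Set (Site (F.P K) 0)) else (∅ : Set (Site (F.P K) 0))) (K - n)) z τ →
        ‖(((F.L : ℝ)⁻¹) ^ (K - n))⁻¹ • (R ⟨(transl 0 z).shift κ, τ⟩ - R ⟨transl 0 z, τ⟩)‖ ≤ K₂ * ε₀ ^ 2) ∧
      (∀ (z : B7Prop1Explicit.Site (F.P K).d) (μ : Fin (F.P K).d),
        BondTouches (pullDom (fun j => if K - n ≤ j then ({x} : Set (Site (F.P K) 0)) else (∅ : Set (Site (F.P K) 0))) (K - n)) z μ →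
        ‖pdiv (((F.L : ℝ)⁻¹) ^ (K - n)) (1 : B7Prop1Explicit.Site (F.P K).d → Fin (F.P K).d → (Matrix (Fin 2) (Fin 2) ℂ)ˣ)
            (plaqCovDeriv (((F.L : ℝ)⁻¹) ^ (K - n)) (1 : B7Prop1Explicit.Site (F.P K).d → Fin (F.P K).d → (Matrix (Fin 2) (Fin 2) ℂ)ˣ)
              (pull R 0)) μ z‖ ≤ K₂ * ε₀ ^ 2) := by
  have hK₁ε : 0 ≤ K₁ * ε₀ ^ 2 := by positivity
  have hK₂ε : 0 ≤ K₂ * ε₀ ^ 2 := by positivity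
  have hpdiv0 : ∀ (μ : Fin (F.P K).d) (z : B7Prop1Explicit.Site (F.P K).d),
      ‖pdiv (((F.L : ℝ)⁻¹) ^ (K - n)) (1 : B7Prop1Explicit.Site (F.P K).d → Fin (F.P K).d → (Matrix (Fin 2) (Fin 2) ℂ)ˣ)
          (plaqCovDeriv (((F.L : ℝ)⁻¹) ^ (K - n)) (1 : B7Prop1Explicit.Site (F.P K).d → Fin (F.P K).d → (Matrix (Fin 2) (Fin 2) ℂ)ˣ)
            (pull (fun _ => 0 : GaugeField (F.P K) 0 (Matrix (Fin 2) (Fin 2) ℂ)) 0)) μ z‖ = 0 := by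
    intro μ z
    rw [Prop8PullbackDict.plaqCovDeriv_flat_pull_zero, Prop8PullbackDict.pdiv_flat_zero, norm_zero]
  refine ⟨fun _ => 1, fun _ => 0, fun _ => 0, fun _ => 0, fun _ => 0, fun _ => IsSelfAdjoint.zero _, fun z μ _ => ?_, ?_, fun c _ _ _ => ?_, fun c _ => ?_,
    fun z τ _ => by rw [norm_zero]; exact hK₁ε, fun z κ τ _ => by rw [sub_zero, smul_zero, norm_zero]; exact hK₁ε, fun z μ _ => by rw [hpdiv0]; exact hK₁ε,
    fun z τ _ => by rw [norm_zero]; exact hK₂ε, fun z κ τ _ => by rw [sub_zero, smul_zero, norm_zero]; exact hK₂ε, fun z μ _ => by rw [hpdiv0]; exact hK₂ε⟩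
  · rw [T3PrintedRegularMinimiser.unitsField_toUField_one, map_one, inv_one, one_mul, one_mul, smul_zero, smul_zero, Prop8PullbackDict.expUnit_zero]
  · funext b
    simp
  · rw [norm_zero]
    have : 0 ≤ distSite (Mk (F.P K) (c.1.1 : ℕ)) c.1.2.src (iterBlockOf (c.1.1 : ℕ) x) := distSite_nonneg _ _
    positivity
  · rw [norm_zero]; positivity

end Sanity

end Summit.QuantumFields.YangMills.Theorems.HalvingPackageSanity

end
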